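import Summits.RiemannHypothesis.RiemannHypothesis.Theorems.LiTailLaguerreFejerPhase
import Literature.Analysis.Fourier.StationaryPhaseSharp
import Literature.Analysis.Fourier.VanDerCorput
import HarnessLib

/-!
# RiemannHypothesis / LiTailLaguerre — Fejér companion, part 2: the pieces of the Laguerre bridge integral (RH-FREE)

RH-FREE [rh-li-eng].  Cell `pub/rh-li`, round 7; sequel to `Theorems/LiTailLaguerreFejerPhase.lean`.  For the
bridge integrand `b_n(t) = 2(1 − cos nθ(t)) cos(ty)` (`θ = liZeroAngle`; `∫_0^∞ b_n = π e^{−y/2} L¹_{n−1}(y)` by the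
tree theorem `Literature.Analysis.SpecialFunctions.integral_liKernel_mul_cos_Ioi`):

* `bridge_trunc_eq` — on `[0, L]`, `∫_0^L b_n = 2 sin(Ly)/y − Re ∫_0^L e^{iF} − Re ∫_0^L e^{iG}`
  (`F = yt + nϑ`, `G = yt − nϑ`, `2(1 − cos nϑ) cos(ty) = 2cos(ty) − cos F − cos G` for `t > 0`);
* `norm_stationary_piece` — **Graham–Kolesnik Lemma 3.4** (tree `GK34.GrahamKolesnik_lemma34`) on `[t₀/2, 2t₀]`:
  `‖∫ e^{iF} − 𝔣 e^{iF(t₀)} F''(t₀)^{−1/2}‖ ≤ 3·10⁹/y` (`λ₂ = n/(20t₀³)`, `λ₃ = 100n/t₀⁴`, `λ₄ = 1000n/t₀⁵`, every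
  error term `≍ t₀²/n ≤ 1/y`);
* `norm_left_piece`, `norm_right_piece`, `norm_G_piece` — van der Corput first-derivative tests (tree
  `norm_integral_exp_I_mul_le_of_deriv_le/ge`): `≤ 2/y` on `[0, t₀/2]` (`F' ≤ −y`), `≤ 4/y` on `[2t₀, L]`
  (`F' ≥ y/2`), `≤ 2/y` for `G` on `[0, L]` (`G' ≥ y`, `G'' ≤ 0`);
* `integrableOn_bridge`, `bridge_split`, `abs_bridge_tail_le` — absolute convergence (`b_n ≤ (n² + 4)/(1 + t²)`),
  `∫_{Ioi 0} = ∫_0^L + ∫_{Ioi L}` and the far tail `|∫_{Ioi L} b_n| ≤ n²/L` (`1 − cos nθ ≤ n²/(2t²)`).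

Nothing here bears on the truth of RH.
-/

noncomputable section

-- D-0017: `Summit.<S>.<S>.…` is the designed namespace of a single-problem summit.
set_option linter.dupNamespace false

open Set MeasureTheory intervalIntegral Complex
open Literature.Analysis.Fourier

namespace Summit.RiemannHypothesis.RiemannHypothesis.Theorems.LiTheory

namespace Fejer

/-! ### The stationary piece: Graham–Kolesnik Lemma 3.4 on `[t₀/2, 2t₀]` -/

/-- **The stationary piece.**  For `0 < y`, `2y ≤ n`:
`‖∫_{t₀/2}^{2t₀} e^{iF} − 𝔣 e^{iF(t₀)} F''(t₀)^{−1/2}‖ ≤ 3·10⁹/y`. -/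
theorem norm_stationary_piece {n : ℕ} {y : ℝ} (hy : 0 < y) (hn : 2 * y ≤ n) :
    ‖(∫ t in (tz n y / 2)..(2 * tz n y), cexp (I * phF n y t))
        - fresnelC * cexp (I * phF n y (tz n y)) * ((Real.sqrt (phF2 n (tz n y)))⁻¹ : ℝ)‖
      ≤ 3 * 10 ^ 9 / y := by
  obtain ⟨hsq, h1, _, _⟩ := tz_facts hy hn
  have hs0 : 0 < tz n y := by linarith
  have hn0 : (0 : ℝ) < n := by
    have : (0 : ℝ) < 2 * y := by positivity
    linarith
  have hs2n : tz n y ^ 2 / n ≤ 1 / y := by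
    have : tz n y ^ 2 ≤ n / y := by rw [hsq]; linarith
    calc tz n y ^ 2 / n ≤ (n / y) / n := by gcongr
      _ = 1 / y := by field_simp
  set s := tz n y with hs
  set lam2 : ℝ := n / (20 * s ^ 3) with hl2
  set lam3 : ℝ := 100 * n / s ^ 4 with hl3
  set lam4 : ℝ := 1000 * n / s ^ 5 with hl4
  have hlam2 : 0 < lam2 := by positivity
  have hlam3 : 0 < lam3 := by positivity
  have hGK := GK34.GrahamKolesnik_lemma34 (F := phF n y) (F' := phF1 n y) (F'' := phF2 n) (F''' := phF3 n)
    (F'''' := phF4 n) (a := s / 2) (b := 2 * s) (c := s) (lam2 := lam2) (lam3 := lam3) (lam4 := lam4)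
    (by linarith) (by linarith) hlam2 hlam3
    (fun x _ ↦ hasDerivAt_phF n y x) (fun x _ ↦ hasDerivAt_phF1 n y x) (fun x _ ↦ hasDerivAt_phF2 n x)
    (fun x _ ↦ hasDerivAt_phF3 n x)
    (fun x hx ↦ (gk_bounds hy hn hx).1) (fun x hx ↦ (gk_bounds hy hn hx).2.1)
    (fun x hx ↦ (gk_bounds hy hn hx).2.2) (phF1_tz hy hn)
  refine hGK.trans ?_
  have hca : s - s / 2 = s / 2 := by ring
  have hbc : 2 * s - s = s := by ring
  have hba : 2 * s - s / 2 = 3 / 2 * s := by ring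
  rw [hca, hbc, hba]
  have e1 : 1 / max (lam2 * (s / 2)) (Real.sqrt lam2) ≤ 40 / y := by
    have hA : 0 < lam2 * (s / 2) := by positivity
    calc 1 / max (lam2 * (s / 2)) (Real.sqrt lam2) ≤ 1 / (lam2 * (s / 2)) :=
          one_div_le_one_div_of_le hA (le_max_left _ _)
      _ = 40 * (s ^ 2 / n) := by rw [hl2]; field_simp; ring
      _ ≤ 40 * (1 / y) := by gcongr
      _ = 40 / y := by ring
  have e2 : 1 / max (lam2 * s) (Real.sqrt lam2) ≤ 20 / y := by
    have hA : 0 < lam2 * s := by positivity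
    calc 1 / max (lam2 * s) (Real.sqrt lam2) ≤ 1 / (lam2 * s) :=
          one_div_le_one_div_of_le hA (le_max_left _ _)
      _ = 20 * (s ^ 2 / n) := by rw [hl2]; field_simp
      _ ≤ 20 * (1 / y) := by gcongr
      _ = 20 / y := by ring
  have e3 : 3 / 2 * s * (lam4 / lam2 ^ 2 + lam3 ^ 2 / lam2 ^ 3) ≤ 120600000 / y := by
    calc 3 / 2 * s * (lam4 / lam2 ^ 2 + lam3 ^ 2 / lam2 ^ 3) = 120600000 * (s ^ 2 / n) := by
          rw [hl2, hl3, hl4]; field_simp; ring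
      _ ≤ 120600000 * (1 / y) := by gcongr
      _ = 120600000 / y := by ring
  have hmax1 : 0 ≤ 1 / max (lam2 * (s / 2)) (Real.sqrt lam2) := by positivity
  have hmax2 : 0 ≤ 1 / max (lam2 * s) (Real.sqrt lam2) := by positivity
  calc 30 * (1 / max (lam2 * (s / 2)) (Real.sqrt lam2) + 1 / max (lam2 * s) (Real.sqrt lam2))
        + 17 * (3 / 2 * s * (lam4 / lam2 ^ 2 + lam3 ^ 2 / lam2 ^ 3))
      ≤ 30 * (40 / y + 20 / y) + 17 * (120600000 / y) := by gcongr
    _ = 2050201800 / y := by ring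
    _ ≤ 3 * 10 ^ 9 / y := by gcongr; norm_num

/-! ### The non-stationary pieces: first-derivative tests -/

/-- `‖∫_0^{t₀/2} e^{iF}‖ ≤ 2/y` (`F' ≤ −y`, `F'' ≥ 0` there). -/
theorem norm_left_piece {n : ℕ} {y : ℝ} (hy : 0 < y) (hn : 2 * y ≤ n) :
    ‖∫ t in (0 : ℝ)..(tz n y / 2), cexp (I * phF n y t)‖ ≤ 2 / y := by
  have h0 : (0 : ℝ) ≤ tz n y / 2 := by linarith [(tz_facts hy hn).2.1]
  exact norm_integral_exp_I_mul_le_of_deriv_le h0 hy (fun x _ ↦ hasDerivAt_phF n y x)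
    (fun x _ ↦ hasDerivAt_phF1 n y x) (continuous_phF2 n).continuousOn
    (Or.inl fun _ hx ↦ phF2_nonneg n hx.1) (fun _ hx ↦ phF1_le_neg hy hn hx.1 hx.2)

/-- `‖∫_{2t₀}^{L} e^{iF}‖ ≤ 4/y` for `L ≥ 2t₀` (`F' ≥ y/2`, `F'' ≥ 0` there). -/
theorem norm_right_piece {n : ℕ} {y : ℝ} (hy : 0 < y) (hn : 2 * y ≤ n) {L : ℝ} (hL : 2 * tz n y ≤ L) :
    ‖∫ t in (2 * tz n y)..L, cexp (I * phF n y t)‖ ≤ 4 / y := by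
  have h1 := (tz_facts hy hn).2.1
  have h := norm_integral_exp_I_mul_le_of_deriv_ge hL (half_pos hy) (fun x _ ↦ hasDerivAt_phF n y x)
    (fun x _ ↦ hasDerivAt_phF1 n y x) (continuous_phF2 n).continuousOn
    (Or.inl fun _ hx ↦ phF2_nonneg n (by linarith [hx.1])) (fun _ hx ↦ phF1_ge hy hn hx.1)
  calc ‖∫ t in (2 * tz n y)..L, cexp (I * phF n y t)‖ ≤ 2 / (y / 2) := h
    _ = 4 / y := by field_simp; ring

/-- `‖∫_0^L e^{iG}‖ ≤ 2/y` (`G' ≥ y`, `G'' ≤ 0`). -/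
theorem norm_G_piece (n : ℕ) {y : ℝ} (hy : 0 < y) {L : ℝ} (hL : 0 ≤ L) :
    ‖∫ t in (0 : ℝ)..L, cexp (I * phG n y t)‖ ≤ 2 / y :=
  norm_integral_exp_I_mul_le_of_deriv_ge hL hy (fun x _ ↦ hasDerivAt_phG n y x)
    (fun x _ ↦ hasDerivAt_phG1 n y x) (continuous_phG2 n).continuousOn
    (Or.inr fun _ hx ↦ phG2_nonpos n hx.1) (fun x _ ↦ phG1_ge n y x)

/-! ### The decomposition on `[0, L]` -/

/-- Pointwise: for `t > 0`, `2(1 − cos nθ(t)) cos(ty) = 2cos(ty) − cos F(t) − cos G(t)`. -/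
theorem bridge_integrand_eq (n : ℕ) (y : ℝ) {t : ℝ} (ht : 0 < t) :
    2 * (1 - Real.cos (n * liZeroAngle t)) * Real.cos (t * y)
      = 2 * Real.cos (t * y) - Real.cos (phF n y t) - Real.cos (phG n y t) := by
  rw [← angS_eq_liZeroAngle ht]
  unfold phF phG
  rw [show y * t + n * angS t = t * y + n * angS t by ring,
    show y * t - n * angS t = t * y - n * angS t by ring, Real.cos_add, Real.cos_sub]
  ring

/-- `∫_0^L cos(ty) dt = sin(Ly)/y` (`y ≠ 0`). -/
theorem integral_cos_mul {y : ℝ} (hy : y ≠ 0) (L : ℝ) :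
    ∫ t in (0 : ℝ)..L, Real.cos (t * y) = Real.sin (L * y) / y := by
  rw [intervalIntegral.integral_comp_mul_right (fun t ↦ Real.cos t) hy, integral_cos]
  simp only [zero_mul, Real.sin_zero, sub_zero, smul_eq_mul]
  rw [inv_mul_eq_div]

/-- `Re ∫_a^b e^{iφ} = ∫_a^b cos φ` for continuous `φ`. -/
theorem re_integral_exp {φ : ℝ → ℝ} (hφ : Continuous φ) (a b : ℝ) :
    (∫ t in a..b, cexp (I * φ t)).re = ∫ t in a..b, Real.cos (φ t) := by
  have hint : IntervalIntegrable (fun t ↦ cexp (I * φ t)) volume a b :=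
    (Complex.continuous_exp.comp (continuous_const.mul (Complex.continuous_ofReal.comp hφ))).intervalIntegrable
      a b
  have h := Complex.reCLM.intervalIntegral_comp_comm hint
  simp only [Complex.reCLM_apply] at h
  rw [← h]
  congr 1
  funext t
  rw [mul_comm, Complex.exp_ofReal_mul_I_re]

/-- **The decomposition.**  For `0 < y`, `0 ≤ L`:
`∫_0^L 2(1 − cos nθ) cos(ty) dt = 2 sin(Ly)/y − Re ∫_0^L e^{iF} − Re ∫_0^L e^{iG}`. -/
theorem bridge_trunc_eq (n : ℕ) {y : ℝ} (hy : 0 < y) {L : ℝ} (hL : 0 ≤ L) :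
    ∫ t in (0 : ℝ)..L, 2 * (1 - Real.cos (n * liZeroAngle t)) * Real.cos (t * y)
      = 2 * (Real.sin (L * y) / y) - (∫ t in (0 : ℝ)..L, cexp (I * phF n y t)).re
          - (∫ t in (0 : ℝ)..L, cexp (I * phG n y t)).re := by
  have h1 : ∫ t in (0 : ℝ)..L, 2 * (1 - Real.cos (n * liZeroAngle t)) * Real.cos (t * y)
      = ∫ t in (0 : ℝ)..L, (2 * Real.cos (t * y) - Real.cos (phF n y t) - Real.cos (phG n y t)) := by
    rw [intervalIntegral.integral_of_le hL, intervalIntegral.integral_of_le hL]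
    refine setIntegral_congr_fun measurableSet_Ioc fun t ht ↦ ?_
    exact bridge_integrand_eq n y ht.1
  rw [h1, re_integral_exp (continuous_phF n y), re_integral_exp (continuous_phG n y)]
  have hc1 : IntervalIntegrable (fun t ↦ 2 * Real.cos (t * y)) volume 0 L := by
    apply Continuous.intervalIntegrable; fun_prop
  have hc2 : IntervalIntegrable (fun t ↦ Real.cos (phF n y t)) volume 0 L :=
    (Real.continuous_cos.comp (continuous_phF n y)).intervalIntegrable 0 L
  have hc3 : IntervalIntegrable (fun t ↦ Real.cos (phG n y t)) volume 0 L :=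
    (Real.continuous_cos.comp (continuous_phG n y)).intervalIntegrable 0 L
  rw [intervalIntegral.integral_sub (hc1.sub hc2) hc3, intervalIntegral.integral_sub hc1 hc2,
    intervalIntegral.integral_const_mul, integral_cos_mul hy.ne' L]

/-! ### Absolute convergence, the split, the far tail -/

/-- Pointwise: for `t > 0`, `|2(1 − cos nθ(t)) cos(ty)| ≤ (n² + 4)/(1 + t²)` and `≤ n²/t²`. -/
theorem abs_bridge_integrand_le (n : ℕ) (y : ℝ) {t : ℝ} (ht : 0 < t) :
    |2 * (1 - Real.cos (n * liZeroAngle t)) * Real.cos (t * y)| ≤ ((n : ℝ) ^ 2 + 4) * (1 + t ^ 2)⁻¹ ∧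
      |2 * (1 - Real.cos (n * liZeroAngle t)) * Real.cos (t * y)| ≤ (n : ℝ) ^ 2 / t ^ 2 := by
  have hw := SmoothReplace.liWindowWeight_le_sq n ht
  obtain ⟨hw0, hw2⟩ := SmoothReplace.liWindowWeight_mem n t
  unfold liWindowWeight at hw hw0 hw2
  have hc : |Real.cos (t * y)| ≤ 1 := Real.abs_cos_le_one _
  rw [abs_mul, abs_mul, abs_of_pos (two_pos : (0 : ℝ) < 2), abs_of_nonneg hw0]
  have hA : 2 * (1 - Real.cos (n * liZeroAngle t)) * |Real.cos (t * y)|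
      ≤ 2 * (1 - Real.cos (n * liZeroAngle t)) := mul_le_of_le_one_right (by positivity) hc
  have hB : 2 * (1 - Real.cos (n * liZeroAngle t)) * t ^ 2 ≤ (n : ℝ) ^ 2 := by
    have := mul_le_mul_of_nonneg_right hw (sq_nonneg t)
    have e : (n : ℝ) ^ 2 / (2 * t ^ 2) * t ^ 2 = n ^ 2 / 2 := by field_simp
    nlinarith
  have h1t : 0 < 1 + t ^ 2 := by positivity
  have ht2 : 0 < t ^ 2 := by positivity
  constructor
  · rw [← div_eq_mul_inv, le_div_iff₀ h1t]
    nlinarith [abs_nonneg (Real.cos (t * y))]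
  · rw [le_div_iff₀ ht2]
    nlinarith [abs_nonneg (Real.cos (t * y))]

/-- The bridge integrand is integrable on `(0, ∞)`. -/
theorem integrableOn_bridge (n : ℕ) (y : ℝ) :
    IntegrableOn (fun t : ℝ ↦ 2 * (1 - Real.cos (n * liZeroAngle t)) * Real.cos (t * y)) (Ioi 0) := by
  have hg : Integrable (fun t : ℝ ↦ ((n : ℝ) ^ 2 + 4) * (1 + t ^ 2)⁻¹) :=
    (integrable_inv_one_add_sq).const_mul _
  have hmeas : AEStronglyMeasurable (fun t : ℝ ↦ 2 * (1 - Real.cos (n * liZeroAngle t)) * Real.cos (t * y))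
      (volume.restrict (Ioi 0)) := by
    have hcw : ContinuousOn (liWindowWeight n) (Ioi 0) :=
      SmoothReplace.continuousOn_liWindowWeight n fun t ht ↦ ne_of_gt ht
    have hcc : Continuous fun t : ℝ ↦ Real.cos (t * y) := by fun_prop
    have hc : ContinuousOn (fun t : ℝ ↦ 2 * liWindowWeight n t * Real.cos (t * y)) (Ioi 0) :=
      (continuousOn_const.mul hcw).mul hcc.continuousOn
    exact hc.aestronglyMeasurable measurableSet_Ioi
  refine Integrable.mono' hg.integrableOn hmeas ?_
  refine (ae_restrict_iff' measurableSet_Ioi).2 (ae_of_all _ fun t ht ↦ ?_)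
  rw [Real.norm_eq_abs]
  exact (abs_bridge_integrand_le n y ht).1

/-- `∫_{Ioi 0} = ∫_0^L + ∫_{Ioi L}` for the bridge integrand (`L ≥ 0`). -/
theorem bridge_split (n : ℕ) (y : ℝ) {L : ℝ} (hL : 0 ≤ L) :
    ∫ t in Ioi (0 : ℝ), 2 * (1 - Real.cos (n * liZeroAngle t)) * Real.cos (t * y)
      = (∫ t in (0 : ℝ)..L, 2 * (1 - Real.cos (n * liZeroAngle t)) * Real.cos (t * y))
          + ∫ t in Ioi L, 2 * (1 - Real.cos (n * liZeroAngle t)) * Real.cos (t * y) := by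
  have h := integrableOn_bridge n y
  rw [intervalIntegral.integral_of_le hL, ← setIntegral_union (Ioc_disjoint_Ioi le_rfl) measurableSet_Ioi
    (h.mono_set Ioc_subset_Ioi_self) (h.mono_set (Ioi_subset_Ioi hL)), Ioc_union_Ioi_eq_Ioi hL]

/-- **The far tail**: `|∫_{Ioi L} 2(1 − cos nθ) cos(ty)| ≤ n²/L` (`L > 0`). -/
theorem abs_bridge_tail_le (n : ℕ) (y : ℝ) {L : ℝ} (hL : 0 < L) :
    |∫ t in Ioi L, 2 * (1 - Real.cos (n * liZeroAngle t)) * Real.cos (t * y)| ≤ (n : ℝ) ^ 2 / L := by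
  have hg : IntegrableOn (fun t : ℝ ↦ (n : ℝ) ^ 2 * t ^ (-2 : ℝ)) (Ioi L) :=
    (integrableOn_Ioi_rpow_of_lt (by norm_num) hL).const_mul _
  have hbound : ∀ᵐ t ∂(volume.restrict (Ioi L)),
      ‖2 * (1 - Real.cos (n * liZeroAngle t)) * Real.cos (t * y)‖ ≤ (n : ℝ) ^ 2 * t ^ (-2 : ℝ) := by
    refine (ae_restrict_iff' measurableSet_Ioi).2 (ae_of_all _ fun t ht ↦ ?_)
    have ht0 : 0 < t := hL.trans ht
    rw [Real.norm_eq_abs]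
    have h := (abs_bridge_integrand_le n y ht0).2
    have e : (t : ℝ) ^ (-2 : ℝ) = 1 / t ^ 2 := by
      rw [Real.rpow_neg ht0.le, show (2 : ℝ) = (2 : ℕ) by norm_num, Real.rpow_natCast, one_div]
    rw [e]
    calc |2 * (1 - Real.cos (n * liZeroAngle t)) * Real.cos (t * y)| ≤ (n : ℝ) ^ 2 / t ^ 2 := h
      _ = (n : ℝ) ^ 2 * (1 / t ^ 2) := by ring
  have h := norm_integral_le_of_norm_le hg hbound
  rw [Real.norm_eq_abs] at h
  refine h.trans (le_of_eq ?_)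
  rw [MeasureTheory.integral_const_mul, integral_Ioi_rpow_of_lt (by norm_num) hL]
  have e : (L : ℝ) ^ ((-2 : ℝ) + 1) = 1 / L := by
    rw [show (-2 : ℝ) + 1 = -1 by norm_num, Real.rpow_neg_one, one_div]
  rw [e]
  field_simp
  norm_num

end Fejer

end Summit.RiemannHypothesis.RiemannHypothesis.Theorems.LiTheory

end
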